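import Summits.ABC.IUTFork.Conditional.HexRefutedLowCellsB
import HarnessLib

/-!
# HEX family `λ_k = 1/2 + 2/7^k` (part C: the class dispatch): the top-label hull cell at `p = 7` FAILS at every odd level `11 ≤ l ≤ 479` for every member of the sharp kernel
# class, UNIFORMLY in `k ≥ 10` — the integer side of the M-line REF glue below the `481 …` bands (row «W:REF-EXACT-M-TWIN», HEX part)

PROOF-ONLY file (D-0012; 0 definitions, 0 `Prop` facts, no instance) of the abc-iut cell — D-0079 RESCUE sub-cell R-W «WINDOW Θ-SIDE INEQUALITY», seat
abc-iut-W-neg-1 (gen 6). PURE ARITHMETIC (abc-iut-rh-typ-4's `HullThresholdExact.HullCell`, the column of R-H row 4), in the byte shape of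
abc-iut-C-cert-1's `RefBand.not_hullCell_hex<k>_A<A>_a<a₀>` / `RefBand.cells_hex<k>_band` (`WRowHexLamSeven<K>RefutedCells`): those start at `l = 481`
because on the K line the range `11 ≤ l ≤ 479` is abc-iut-W-neg-2's explicit-depth rad theorem `HexRad.not_pilotKummerCompatHull_lamSeven_rad_eleven`
(`k ≥ 11`), which has no M-line twin. The M-line hull-cell engine (this seat's `GenuineM.not_pilotKummerCompatHull_triple_of_hullCells_tameSharp`,
p528325) needs only the failing cells, and at `p = 7`, `v = k` they fail on the WHOLE low range for EVERY `k ≥ 10` (desk: exact integers, every odd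
`l`, every class member, floor-free margin positive at the least admissible `k` and increasing in `k`):

* `RefBand.not_hullCell_hexlow_A<A>_a<a₀>` — for each `A ∣ 30` and each turning-point piece (`7^{a₀−1}·6 < A·l ≤ 7^{a₀}·6`) of `11 ≤ l = 2j+1 ≤ 479`:
  `k ≥ k_A` (the least `k ≥ 10` compatible with the sharp class clauses for that `A`: `15 ∣ A·k`, `k` even ⇒ `A ∣ 15`, `3 ∣ k ⇒ A ∣ 10`,
  `5 ∣ k ⇒ A ∣ 6`) and ANY inner radius with `6·r_in ≤ A·l + 6` ⟹ `¬ HullCell (A·l) (A·k) j r_in (7^{a₀} − a₀·A·l)` (`e·⌊X/e⌋ ≥ X − e + 1`; the margin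
  is linear INCREASING in `k` and a downward parabola in `j` positive on the piece — `nlinarith`);
* **`RefBand.cells_hex_low`** — `10 ≤ k`, odd `11 ≤ l ≤ 479`, top label `i + 1 = (l−1)/2`, `A` in the sharp class at `(p, v) = (7, k)` ⟹ the engine's
  `hcell` conclusion `∃ a₀, (turning point of A·l at 7) ∧ ¬ HullCell (A·l) (A·k) (i+1) (⌊A·l/6⌋+1) (7^{a₀} − a₀·A·l)`.
Consumers: the M twins `GenuineM.not_pilotKummerCompatHull_triple_lamSeven_<k>_le` (this row), gluing this with the `481 …` band cells of
abc-iut-C-cert-1 / abc-iut-w6-d055 BY NAME. HONEST SCOPE: integer inequalities only; nothing about any datum, (P6), admissibility or [IUTchIII] Cor. 3.12;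
no side taken; no abc claim. [cite: Mochizuki2012, IUTchIV Prop. 1.1 p. 9, Prop. 1.2 (i)(ii) p. 10] [cite: DupuyHilado2025, §4.9] [claim: Mochizuki2012, status: disputed]
-/

noncomputable section

namespace Summit.ABC.IUTFork.Conditional

open Summit.ABC.IUTFork.Repair.RH.HullThresholdExact

/-! ## §2. The engine's `hcell` on the low range, every `k ≥ 10`, every sharp-class member -/

/-- **HEX, low range: the hull-cell engine's `hcell` at `p = 7`, `v = k`, for EVERY `k ≥ 10`, EVERY odd `11 ≤ l ≤ 479`, top label, EVERY member `A` of the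
sharp kernel class** (`A ∣ 30`, `15 ∣ A·k`, `k` even ⇒ `A ∣ 15`, `3 ∣ k ⇒ A ∣ 10`, `5 ∣ k ⇒ A ∣ 6`): a turning point `a₀` of `A·l` with
`¬ HullCell (A·l) (A·k) (i+1) (⌊A·l/6⌋+1) (7^{a₀} − a₀·A·l)`. Dispatch on `A ∈ {1, 2, 3, 5, 6, 10, 15, 30}` (the class clauses give the least admissible
`k` per member) and on the turning-point piece of `l`; §1 per piece. [folklore] -/
theorem RefBand.cells_hex_low {k l : ℕ} (hk : 10 ≤ k) (hlo : 11 ≤ l) (hhi : l ≤ 479) (hodd : Odd l) {i : ℕ} (hi : i + 1 = (l - 1) / 2)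
    (A : ℕ) (hA30 : A ∣ 30) (hA15 : 15 ∣ A * k) (hAev : Even k → A ∣ 15) (hA3 : 3 ∣ k → A ∣ 10) (hA5 : 5 ∣ k → A ∣ 6) :
    ∃ a₀ : ℕ, (∀ s : ℕ, s < a₀ → (1 : ℤ) * ((7 : ℕ) : ℤ) ^ s * (((7 : ℕ) : ℤ) - 1) < ((A * l : ℕ) : ℤ)) ∧
      ((A * l : ℕ) : ℤ) ≤ 1 * ((7 : ℕ) : ℤ) ^ a₀ * (((7 : ℕ) : ℤ) - 1) ∧
      ¬ HullCell ((A * l : ℕ) : ℤ) ((A * k : ℕ) : ℤ) ((i : ℤ) + 1) (((A * l) / ((7 : ℕ) - 1) + 1 : ℕ) : ℤ)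
        (((7 : ℕ) : ℤ) ^ a₀ - (a₀ : ℤ) * ((A * l : ℕ) : ℤ)) := by
  obtain ⟨j, hj⟩ := hodd
  have hij : (i : ℤ) + 1 = (j : ℤ) := by
    have : i + 1 = j := by omega
    exact_mod_cast this
  have hA31 : A ≤ 30 := Nat.le_of_dvd (by norm_num) hA30
  interval_cases A
  all_goals first
    | (exfalso; revert hA30; decide)
    | skip
  · -- A = 1: least admissible k is 15
    have hkA : 15 ≤ k := by
      have h15k : 15 ∣ k := by
        have : 15 ∣ 1 * k := hA15
        omega
      omega
    have hkZ : (15 : ℤ) ≤ (k : ℤ) := by exact_mod_cast hkA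
    have he : ((1 * l : ℕ) : ℤ) = 1 * (2 * (j : ℤ) + 1) := by push_cast; omega
    have hm : ((1 * k : ℕ) : ℤ) = 1 * (k : ℤ) := by push_cast; ring
    have hr : (6 : ℤ) * (((((1 * l) / ((7 : ℕ) - 1) + 1 : ℕ) : ℤ))) ≤ 1 * (2 * (j : ℤ) + 1) + 6 := by
      have h0 : ((7 : ℕ) - 1) * ((1 * l) / ((7 : ℕ) - 1)) ≤ 1 * l := Nat.mul_div_le _ _
      have h1 : (6 : ℤ) * ((((1 * l) / ((7 : ℕ) - 1) : ℕ) : ℤ)) ≤ ((1 * l : ℕ) : ℤ) := by exact_mod_cast h0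
      push_cast at h1 ⊢; omega
    by_cases hp0 : 11 ≤ l ∧ l ≤ 41
    · refine ⟨1, fun s hs => ?_, ?_, ?_⟩
      · interval_cases s; norm_num; omega
      · norm_num; omega
      · have hro : (((7 : ℕ) : ℤ) ^ 1 - ((1 : ℕ) : ℤ) * ((1 * l : ℕ) : ℤ)) = 7 - 1 * (1 * (2 * (j : ℤ) + 1)) := by
          push_cast; omega
        rw [hro, hij, he, hm]
        exact RefBand.not_hullCell_hexlow_A1_a1 hkZ (by omega) (by omega) hr
    by_cases hp1 : 43 ≤ l ∧ l ≤ 293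
    · refine ⟨2, fun s hs => ?_, ?_, ?_⟩
      · interval_cases s <;> norm_num <;> omega
      · norm_num; omega
      · have hro : (((7 : ℕ) : ℤ) ^ 2 - ((2 : ℕ) : ℤ) * ((1 * l : ℕ) : ℤ)) = 49 - 2 * (1 * (2 * (j : ℤ) + 1)) := by
          push_cast; omega
        rw [hro, hij, he, hm]
        exact RefBand.not_hullCell_hexlow_A1_a2 hkZ (by omega) (by omega) hr
    by_cases hp2 : 295 ≤ l ∧ l ≤ 479
    · refine ⟨3, fun s hs => ?_, ?_, ?_⟩
      · interval_cases s <;> norm_num <;> omega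
      · norm_num; omega
      · have hro : (((7 : ℕ) : ℤ) ^ 3 - ((3 : ℕ) : ℤ) * ((1 * l : ℕ) : ℤ)) = 343 - 3 * (1 * (2 * (j : ℤ) + 1)) := by
          push_cast; omega
        rw [hro, hij, he, hm]
        exact RefBand.not_hullCell_hexlow_A1_a3 hkZ (by omega) (by omega) hr
    exfalso; omega
  · -- A = 2: least admissible k is 15
    have hkA : 15 ≤ k := by
      have h15k : 15 ∣ k := by
        have : 15 ∣ 2 * k := hA15
        omega
      have hko : ¬ Even k := fun h => by have := hAev h; omega
      have hko' : k % 2 = 1 := Nat.odd_iff.mp (Nat.not_even_iff_odd.mp hko)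
      omega
    have hkZ : (15 : ℤ) ≤ (k : ℤ) := by exact_mod_cast hkA
    have he : ((2 * l : ℕ) : ℤ) = 2 * (2 * (j : ℤ) + 1) := by push_cast; omega
    have hm : ((2 * k : ℕ) : ℤ) = 2 * (k : ℤ) := by push_cast; ring
    have hr : (6 : ℤ) * (((((2 * l) / ((7 : ℕ) - 1) + 1 : ℕ) : ℤ))) ≤ 2 * (2 * (j : ℤ) + 1) + 6 := by
      have h0 : ((7 : ℕ) - 1) * ((2 * l) / ((7 : ℕ) - 1)) ≤ 2 * l := Nat.mul_div_le _ _
      have h1 : (6 : ℤ) * ((((2 * l) / ((7 : ℕ) - 1) : ℕ) : ℤ)) ≤ ((2 * l : ℕ) : ℤ) := by exact_mod_cast h0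
      push_cast at h1 ⊢; omega
    by_cases hp0 : 11 ≤ l ∧ l ≤ 21
    · refine ⟨1, fun s hs => ?_, ?_, ?_⟩
      · interval_cases s; norm_num; omega
      · norm_num; omega
      · have hro : (((7 : ℕ) : ℤ) ^ 1 - ((1 : ℕ) : ℤ) * ((2 * l : ℕ) : ℤ)) = 7 - 1 * (2 * (2 * (j : ℤ) + 1)) := by
          push_cast; omega
        rw [hro, hij, he, hm]
        exact RefBand.not_hullCell_hexlow_A2_a1 hkZ (by omega) (by omega) hr
    by_cases hp1 : 23 ≤ l ∧ l ≤ 147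
    · refine ⟨2, fun s hs => ?_, ?_, ?_⟩
      · interval_cases s <;> norm_num <;> omega
      · norm_num; omega
      · have hro : (((7 : ℕ) : ℤ) ^ 2 - ((2 : ℕ) : ℤ) * ((2 * l : ℕ) : ℤ)) = 49 - 2 * (2 * (2 * (j : ℤ) + 1)) := by
          push_cast; omega
        rw [hro, hij, he, hm]
        exact RefBand.not_hullCell_hexlow_A2_a2 hkZ (by omega) (by omega) hr
    by_cases hp2 : 149 ≤ l ∧ l ≤ 479
    · refine ⟨3, fun s hs => ?_, ?_, ?_⟩
      · interval_cases s <;> norm_num <;> omega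
      · norm_num; omega
      · have hro : (((7 : ℕ) : ℤ) ^ 3 - ((3 : ℕ) : ℤ) * ((2 * l : ℕ) : ℤ)) = 343 - 3 * (2 * (2 * (j : ℤ) + 1)) := by
          push_cast; omega
        rw [hro, hij, he, hm]
        exact RefBand.not_hullCell_hexlow_A2_a3 hkZ (by omega) (by omega) hr
    exfalso; omega
  · -- A = 3: least admissible k is 10
    have hkA : 10 ≤ k := by
      have h15k : 5 ∣ k := by
        have : 15 ∣ 3 * k := hA15
        omega
      have hk3 : ¬ 3 ∣ k := fun h => by have := hA3 h; omega
      omega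
    have hkZ : (10 : ℤ) ≤ (k : ℤ) := by exact_mod_cast hkA
    have he : ((3 * l : ℕ) : ℤ) = 3 * (2 * (j : ℤ) + 1) := by push_cast; omega
    have hm : ((3 * k : ℕ) : ℤ) = 3 * (k : ℤ) := by push_cast; ring
    have hr : (6 : ℤ) * (((((3 * l) / ((7 : ℕ) - 1) + 1 : ℕ) : ℤ))) ≤ 3 * (2 * (j : ℤ) + 1) + 6 := by
      have h0 : ((7 : ℕ) - 1) * ((3 * l) / ((7 : ℕ) - 1)) ≤ 3 * l := Nat.mul_div_le _ _
      have h1 : (6 : ℤ) * ((((3 * l) / ((7 : ℕ) - 1) : ℕ) : ℤ)) ≤ ((3 * l : ℕ) : ℤ) := by exact_mod_cast h0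
      push_cast at h1 ⊢; omega
    by_cases hp0 : 11 ≤ l ∧ l ≤ 13
    · refine ⟨1, fun s hs => ?_, ?_, ?_⟩
      · interval_cases s; norm_num; omega
      · norm_num; omega
      · have hro : (((7 : ℕ) : ℤ) ^ 1 - ((1 : ℕ) : ℤ) * ((3 * l : ℕ) : ℤ)) = 7 - 1 * (3 * (2 * (j : ℤ) + 1)) := by
          push_cast; omega
        rw [hro, hij, he, hm]
        exact RefBand.not_hullCell_hexlow_A3_a1 hkZ (by omega) (by omega) hr
    by_cases hp1 : 15 ≤ l ∧ l ≤ 97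
    · refine ⟨2, fun s hs => ?_, ?_, ?_⟩
      · interval_cases s <;> norm_num <;> omega
      · norm_num; omega
      · have hro : (((7 : ℕ) : ℤ) ^ 2 - ((2 : ℕ) : ℤ) * ((3 * l : ℕ) : ℤ)) = 49 - 2 * (3 * (2 * (j : ℤ) + 1)) := by
          push_cast; omega
        rw [hro, hij, he, hm]
        exact RefBand.not_hullCell_hexlow_A3_a2 hkZ (by omega) (by omega) hr
    by_cases hp2 : 99 ≤ l ∧ l ≤ 479
    · refine ⟨3, fun s hs => ?_, ?_, ?_⟩
      · interval_cases s <;> norm_num <;> omega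
      · norm_num; omega
      · have hro : (((7 : ℕ) : ℤ) ^ 3 - ((3 : ℕ) : ℤ) * ((3 * l : ℕ) : ℤ)) = 343 - 3 * (3 * (2 * (j : ℤ) + 1)) := by
          push_cast; omega
        rw [hro, hij, he, hm]
        exact RefBand.not_hullCell_hexlow_A3_a3 hkZ (by omega) (by omega) hr
    exfalso; omega
  · -- A = 5: least admissible k is 12
    have hkA : 12 ≤ k := by
      have h15k : 3 ∣ k := by
        have : 15 ∣ 5 * k := hA15
        omega
      have hk5 : ¬ 5 ∣ k := fun h => by have := hA5 h; omega
      omega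
    have hkZ : (12 : ℤ) ≤ (k : ℤ) := by exact_mod_cast hkA
    have he : ((5 * l : ℕ) : ℤ) = 5 * (2 * (j : ℤ) + 1) := by push_cast; omega
    have hm : ((5 * k : ℕ) : ℤ) = 5 * (k : ℤ) := by push_cast; ring
    have hr : (6 : ℤ) * (((((5 * l) / ((7 : ℕ) - 1) + 1 : ℕ) : ℤ))) ≤ 5 * (2 * (j : ℤ) + 1) + 6 := by
      have h0 : ((7 : ℕ) - 1) * ((5 * l) / ((7 : ℕ) - 1)) ≤ 5 * l := Nat.mul_div_le _ _
      have h1 : (6 : ℤ) * ((((5 * l) / ((7 : ℕ) - 1) : ℕ) : ℤ)) ≤ ((5 * l : ℕ) : ℤ) := by exact_mod_cast h0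
      push_cast at h1 ⊢; omega
    by_cases hp0 : 11 ≤ l ∧ l ≤ 57
    · refine ⟨2, fun s hs => ?_, ?_, ?_⟩
      · interval_cases s <;> norm_num <;> omega
      · norm_num; omega
      · have hro : (((7 : ℕ) : ℤ) ^ 2 - ((2 : ℕ) : ℤ) * ((5 * l : ℕ) : ℤ)) = 49 - 2 * (5 * (2 * (j : ℤ) + 1)) := by
          push_cast; omega
        rw [hro, hij, he, hm]
        exact RefBand.not_hullCell_hexlow_A5_a2 hkZ (by omega) (by omega) hr
    by_cases hp1 : 59 ≤ l ∧ l ≤ 411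
    · refine ⟨3, fun s hs => ?_, ?_, ?_⟩
      · interval_cases s <;> norm_num <;> omega
      · norm_num; omega
      · have hro : (((7 : ℕ) : ℤ) ^ 3 - ((3 : ℕ) : ℤ) * ((5 * l : ℕ) : ℤ)) = 343 - 3 * (5 * (2 * (j : ℤ) + 1)) := by
          push_cast; omega
        rw [hro, hij, he, hm]
        exact RefBand.not_hullCell_hexlow_A5_a3 hkZ (by omega) (by omega) hr
    by_cases hp2 : 413 ≤ l ∧ l ≤ 479
    · refine ⟨4, fun s hs => ?_, ?_, ?_⟩
      · interval_cases s <;> norm_num <;> omega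
      · norm_num; omega
      · have hro : (((7 : ℕ) : ℤ) ^ 4 - ((4 : ℕ) : ℤ) * ((5 * l : ℕ) : ℤ)) = 2401 - 4 * (5 * (2 * (j : ℤ) + 1)) := by
          push_cast; omega
        rw [hro, hij, he, hm]
        exact RefBand.not_hullCell_hexlow_A5_a4 hkZ (by omega) (by omega) hr
    exfalso; omega
  · -- A = 6: least admissible k is 25
    have hkA : 25 ≤ k := by
      have h15k : 5 ∣ k := by
        have : 15 ∣ 6 * k := hA15
        omega
      have hko : ¬ Even k := fun h => by have := hAev h; omega
      have hko' : k % 2 = 1 := Nat.odd_iff.mp (Nat.not_even_iff_odd.mp hko)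
      have hk3 : ¬ 3 ∣ k := fun h => by have := hA3 h; omega
      omega
    have hkZ : (25 : ℤ) ≤ (k : ℤ) := by exact_mod_cast hkA
    have he : ((6 * l : ℕ) : ℤ) = 6 * (2 * (j : ℤ) + 1) := by push_cast; omega
    have hm : ((6 * k : ℕ) : ℤ) = 6 * (k : ℤ) := by push_cast; ring
    have hr : (6 : ℤ) * (((((6 * l) / ((7 : ℕ) - 1) + 1 : ℕ) : ℤ))) ≤ 6 * (2 * (j : ℤ) + 1) + 6 := by
      have h0 : ((7 : ℕ) - 1) * ((6 * l) / ((7 : ℕ) - 1)) ≤ 6 * l := Nat.mul_div_le _ _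
      have h1 : (6 : ℤ) * ((((6 * l) / ((7 : ℕ) - 1) : ℕ) : ℤ)) ≤ ((6 * l : ℕ) : ℤ) := by exact_mod_cast h0
      push_cast at h1 ⊢; omega
    by_cases hp0 : 11 ≤ l ∧ l ≤ 49
    · refine ⟨2, fun s hs => ?_, ?_, ?_⟩
      · interval_cases s <;> norm_num <;> omega
      · norm_num; omega
      · have hro : (((7 : ℕ) : ℤ) ^ 2 - ((2 : ℕ) : ℤ) * ((6 * l : ℕ) : ℤ)) = 49 - 2 * (6 * (2 * (j : ℤ) + 1)) := by
          push_cast; omega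
        rw [hro, hij, he, hm]
        exact RefBand.not_hullCell_hexlow_A6_a2 hkZ (by omega) (by omega) hr
    by_cases hp1 : 51 ≤ l ∧ l ≤ 343
    · refine ⟨3, fun s hs => ?_, ?_, ?_⟩
      · interval_cases s <;> norm_num <;> omega
      · norm_num; omega
      · have hro : (((7 : ℕ) : ℤ) ^ 3 - ((3 : ℕ) : ℤ) * ((6 * l : ℕ) : ℤ)) = 343 - 3 * (6 * (2 * (j : ℤ) + 1)) := by
          push_cast; omega
        rw [hro, hij, he, hm]
        exact RefBand.not_hullCell_hexlow_A6_a3 hkZ (by omega) (by omega) hr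
    by_cases hp2 : 345 ≤ l ∧ l ≤ 479
    · refine ⟨4, fun s hs => ?_, ?_, ?_⟩
      · interval_cases s <;> norm_num <;> omega
      · norm_num; omega
      · have hro : (((7 : ℕ) : ℤ) ^ 4 - ((4 : ℕ) : ℤ) * ((6 * l : ℕ) : ℤ)) = 2401 - 4 * (6 * (2 * (j : ℤ) + 1)) := by
          push_cast; omega
        rw [hro, hij, he, hm]
        exact RefBand.not_hullCell_hexlow_A6_a4 hkZ (by omega) (by omega) hr
    exfalso; omega
  · -- A = 10: least admissible k is 21
    have hkA : 21 ≤ k := by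
      have h15k : 3 ∣ k := by
        have : 15 ∣ 10 * k := hA15
        omega
      have hko : ¬ Even k := fun h => by have := hAev h; omega
      have hko' : k % 2 = 1 := Nat.odd_iff.mp (Nat.not_even_iff_odd.mp hko)
      have hk5 : ¬ 5 ∣ k := fun h => by have := hA5 h; omega
      omega
    have hkZ : (21 : ℤ) ≤ (k : ℤ) := by exact_mod_cast hkA
    have he : ((10 * l : ℕ) : ℤ) = 10 * (2 * (j : ℤ) + 1) := by push_cast; omega
    have hm : ((10 * k : ℕ) : ℤ) = 10 * (k : ℤ) := by push_cast; ring
    have hr : (6 : ℤ) * (((((10 * l) / ((7 : ℕ) - 1) + 1 : ℕ) : ℤ))) ≤ 10 * (2 * (j : ℤ) + 1) + 6 := by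
      have h0 : ((7 : ℕ) - 1) * ((10 * l) / ((7 : ℕ) - 1)) ≤ 10 * l := Nat.mul_div_le _ _
      have h1 : (6 : ℤ) * ((((10 * l) / ((7 : ℕ) - 1) : ℕ) : ℤ)) ≤ ((10 * l : ℕ) : ℤ) := by exact_mod_cast h0
      push_cast at h1 ⊢; omega
    by_cases hp0 : 11 ≤ l ∧ l ≤ 29
    · refine ⟨2, fun s hs => ?_, ?_, ?_⟩
      · interval_cases s <;> norm_num <;> omega
      · norm_num; omega
      · have hro : (((7 : ℕ) : ℤ) ^ 2 - ((2 : ℕ) : ℤ) * ((10 * l : ℕ) : ℤ)) = 49 - 2 * (10 * (2 * (j : ℤ) + 1)) := by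
          push_cast; omega
        rw [hro, hij, he, hm]
        exact RefBand.not_hullCell_hexlow_A10_a2 hkZ (by omega) (by omega) hr
    by_cases hp1 : 31 ≤ l ∧ l ≤ 205
    · refine ⟨3, fun s hs => ?_, ?_, ?_⟩
      · interval_cases s <;> norm_num <;> omega
      · norm_num; omega
      · have hro : (((7 : ℕ) : ℤ) ^ 3 - ((3 : ℕ) : ℤ) * ((10 * l : ℕ) : ℤ)) = 343 - 3 * (10 * (2 * (j : ℤ) + 1)) := by
          push_cast; omega
        rw [hro, hij, he, hm]
        exact RefBand.not_hullCell_hexlow_A10_a3 hkZ (by omega) (by omega) hr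
    by_cases hp2 : 207 ≤ l ∧ l ≤ 479
    · refine ⟨4, fun s hs => ?_, ?_, ?_⟩
      · interval_cases s <;> norm_num <;> omega
      · norm_num; omega
      · have hro : (((7 : ℕ) : ℤ) ^ 4 - ((4 : ℕ) : ℤ) * ((10 * l : ℕ) : ℤ)) = 2401 - 4 * (10 * (2 * (j : ℤ) + 1)) := by
          push_cast; omega
        rw [hro, hij, he, hm]
        exact RefBand.not_hullCell_hexlow_A10_a4 hkZ (by omega) (by omega) hr
    exfalso; omega
  · -- A = 15: least admissible k is 11
    have hkA : 11 ≤ k := by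
      have h15k : True := trivial
      have hk3 : ¬ 3 ∣ k := fun h => by have := hA3 h; omega
      have hk5 : ¬ 5 ∣ k := fun h => by have := hA5 h; omega
      omega
    have hkZ : (11 : ℤ) ≤ (k : ℤ) := by exact_mod_cast hkA
    have he : ((15 * l : ℕ) : ℤ) = 15 * (2 * (j : ℤ) + 1) := by push_cast; omega
    have hm : ((15 * k : ℕ) : ℤ) = 15 * (k : ℤ) := by push_cast; ring
    have hr : (6 : ℤ) * (((((15 * l) / ((7 : ℕ) - 1) + 1 : ℕ) : ℤ))) ≤ 15 * (2 * (j : ℤ) + 1) + 6 := by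
      have h0 : ((7 : ℕ) - 1) * ((15 * l) / ((7 : ℕ) - 1)) ≤ 15 * l := Nat.mul_div_le _ _
      have h1 : (6 : ℤ) * ((((15 * l) / ((7 : ℕ) - 1) : ℕ) : ℤ)) ≤ ((15 * l : ℕ) : ℤ) := by exact_mod_cast h0
      push_cast at h1 ⊢; omega
    by_cases hp0 : 11 ≤ l ∧ l ≤ 19
    · refine ⟨2, fun s hs => ?_, ?_, ?_⟩
      · interval_cases s <;> norm_num <;> omega
      · norm_num; omega
      · have hro : (((7 : ℕ) : ℤ) ^ 2 - ((2 : ℕ) : ℤ) * ((15 * l : ℕ) : ℤ)) = 49 - 2 * (15 * (2 * (j : ℤ) + 1)) := by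
          push_cast; omega
        rw [hro, hij, he, hm]
        exact RefBand.not_hullCell_hexlow_A15_a2 hkZ (by omega) (by omega) hr
    by_cases hp1 : 21 ≤ l ∧ l ≤ 137
    · refine ⟨3, fun s hs => ?_, ?_, ?_⟩
      · interval_cases s <;> norm_num <;> omega
      · norm_num; omega
      · have hro : (((7 : ℕ) : ℤ) ^ 3 - ((3 : ℕ) : ℤ) * ((15 * l : ℕ) : ℤ)) = 343 - 3 * (15 * (2 * (j : ℤ) + 1)) := by
          push_cast; omega
        rw [hro, hij, he, hm]
        exact RefBand.not_hullCell_hexlow_A15_a3 hkZ (by omega) (by omega) hr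
    by_cases hp2 : 139 ≤ l ∧ l ≤ 479
    · refine ⟨4, fun s hs => ?_, ?_, ?_⟩
      · interval_cases s <;> norm_num <;> omega
      · norm_num; omega
      · have hro : (((7 : ℕ) : ℤ) ^ 4 - ((4 : ℕ) : ℤ) * ((15 * l : ℕ) : ℤ)) = 2401 - 4 * (15 * (2 * (j : ℤ) + 1)) := by
          push_cast; omega
        rw [hro, hij, he, hm]
        exact RefBand.not_hullCell_hexlow_A15_a4 hkZ (by omega) (by omega) hr
    exfalso; omega
  · -- A = 30: least admissible k is 11
    have hkA : 11 ≤ k := by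
      have h15k : True := trivial
      have hko : ¬ Even k := fun h => by have := hAev h; omega
      have hko' : k % 2 = 1 := Nat.odd_iff.mp (Nat.not_even_iff_odd.mp hko)
      have hk3 : ¬ 3 ∣ k := fun h => by have := hA3 h; omega
      have hk5 : ¬ 5 ∣ k := fun h => by have := hA5 h; omega
      omega
    have hkZ : (11 : ℤ) ≤ (k : ℤ) := by exact_mod_cast hkA
    have he : ((30 * l : ℕ) : ℤ) = 30 * (2 * (j : ℤ) + 1) := by push_cast; omega
    have hm : ((30 * k : ℕ) : ℤ) = 30 * (k : ℤ) := by push_cast; ring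
    have hr : (6 : ℤ) * (((((30 * l) / ((7 : ℕ) - 1) + 1 : ℕ) : ℤ))) ≤ 30 * (2 * (j : ℤ) + 1) + 6 := by
      have h0 : ((7 : ℕ) - 1) * ((30 * l) / ((7 : ℕ) - 1)) ≤ 30 * l := Nat.mul_div_le _ _
      have h1 : (6 : ℤ) * ((((30 * l) / ((7 : ℕ) - 1) : ℕ) : ℤ)) ≤ ((30 * l : ℕ) : ℤ) := by exact_mod_cast h0
      push_cast at h1 ⊢; omega
    by_cases hp0 : 11 ≤ l ∧ l ≤ 67
    · refine ⟨3, fun s hs => ?_, ?_, ?_⟩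
      · interval_cases s <;> norm_num <;> omega
      · norm_num; omega
      · have hro : (((7 : ℕ) : ℤ) ^ 3 - ((3 : ℕ) : ℤ) * ((30 * l : ℕ) : ℤ)) = 343 - 3 * (30 * (2 * (j : ℤ) + 1)) := by
          push_cast; omega
        rw [hro, hij, he, hm]
        exact RefBand.not_hullCell_hexlow_A30_a3 hkZ (by omega) (by omega) hr
    by_cases hp1 : 69 ≤ l ∧ l ≤ 479
    · refine ⟨4, fun s hs => ?_, ?_, ?_⟩
      · interval_cases s <;> norm_num <;> omega
      · norm_num; omega
      · have hro : (((7 : ℕ) : ℤ) ^ 4 - ((4 : ℕ) : ℤ) * ((30 * l : ℕ) : ℤ)) = 2401 - 4 * (30 * (2 * (j : ℤ) + 1)) := by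
          push_cast; omega
        rw [hro, hij, he, hm]
        exact RefBand.not_hullCell_hexlow_A30_a4 hkZ (by omega) (by omega) hr
    exfalso; omega


end Summit.ABC.IUTFork.Conditional

end
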